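import Literature.Computability.Complexity.SkeletonConstraints
import Literature.Computability.Complexity.SkeletonTableauComplete
import HarnessLib

/-!
# The quasi-linear tableau of a flat stack program, V: the numeric layout and the clause function

Literature / circuit complexity (serves `williams_acc` through the leaf
`Williams2014_fact_3_1_skeleton`; see `SkeletonTableau.lean`). The tableau variables are laid
out as numbers (`addr`, mixed radix over a tag, a register index, a time-like index and two
small indices; the auxiliary variables of the clause compilation in a separate block), the flat
family of constraints (`…Constraints`) is numbered likewise (`conN`), and the clause function of
the skeleton reduction is defined (`skTab tb i b`: the unit clause `xᵢ = b` for `i < n`, then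
`256` compiled clauses per constraint, `ThreeCNFCompiler.lean`, then tautologies). Proved:
clauses have width `≤ 3` (`length_skTab_le`), their variables are `< Vtot` (`vars_skTab_lt`),
clauses are `tautClause` from `n + 256 · NC` on (`skTab_taut`), and **satisfiability of the
presented formula is equivalent to `TabOK` with the input spelled on the input-copy
variables** (`sat_skTab_iff`), hence (by `…Sound`/`…Complete`) to acceptance of some short
witness by the flat program (`sat_skTab_iff_run`).
-/

namespace Literature.Computability.Complexity

namespace Tableau

open StackEvents FlatRun Benes

namespace TabParams

variable (tb : TabParams)

/-- Number of index tuples of one tag / one family. [folklore] -/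
def M : ℕ := tb.K * (tb.S2 * (tb.D * tb.D))
/-- Size of the main variable block. [folklore] -/
def VMAIN : ℕ := 16 * tb.M
/-- Number of constraint ids. [folklore] -/
def NC : ℕ := 32 * tb.M
/-- Bound on all variable indices. [folklore] -/
def Vtot : ℕ := tb.VMAIN + 256 * tb.NC
/-- Number of meaningful clause indices. [folklore] -/
def NCl : ℕ := tb.n + 256 * tb.NC

end TabParams

section Layout

variable (tb : TabParams)

/-- Mixed-radix packing of an index tuple. [folklore] -/
def mix (κ s a b : ℕ) : ℕ := κ + tb.K * (s + tb.S2 * (a + tb.D * b))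

/-- A packed index tuple with in-range digits is below `M`. [folklore] -/
theorem mix_lt {κ s a b : ℕ} (hκ : κ < tb.K) (hs : s < tb.S2) (ha : a < tb.D) (hb : b < tb.D) :
    mix tb κ s a b < tb.M := by
  unfold mix TabParams.M
  have h1 : a + tb.D * b < tb.D * tb.D := by
    calc a + tb.D * b < tb.D + tb.D * b := by omega
      _ = tb.D * (b + 1) := by ring
      _ ≤ tb.D * tb.D := Nat.mul_le_mul_left _ hb
  have h2 : s + tb.S2 * (a + tb.D * b) < tb.S2 * (tb.D * tb.D) := by
    calc s + tb.S2 * (a + tb.D * b) < tb.S2 + tb.S2 * (a + tb.D * b) := by omega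
      _ = tb.S2 * (a + tb.D * b + 1) := by ring
      _ ≤ tb.S2 * (tb.D * tb.D) := Nat.mul_le_mul_left _ h1
  calc κ + tb.K * (s + tb.S2 * (a + tb.D * b)) < tb.K + tb.K * (s + tb.S2 * (a + tb.D * b)) := by omega
    _ = tb.K * (s + tb.S2 * (a + tb.D * b) + 1) := by ring
    _ ≤ tb.K * (tb.S2 * (tb.D * tb.D)) := Nat.mul_le_mul_left _ h2

/-- Unpacking: the register digit. [folklore] -/
theorem mix_mod (κ s a b : ℕ) (hκ : κ < tb.K) : mix tb κ s a b % tb.K = κ := by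
  unfold mix; rw [Nat.add_mul_mod_self_left, Nat.mod_eq_of_lt hκ]
/-- Unpacking: past the register digit. [folklore] -/
theorem mix_div (κ s a b : ℕ) (hκ : κ < tb.K) : mix tb κ s a b / tb.K = s + tb.S2 * (a + tb.D * b) := by
  unfold mix; rw [Nat.add_mul_div_left _ _ (by omega), Nat.div_eq_of_lt hκ, Nat.zero_add]

/-- The address of a tagged index tuple. [folklore] -/
def enc (t κ s a b : ℕ) : ℕ := t + 16 * mix tb κ s a b

/-- **The numeric layout of the tableau variables.** [folklore] -/
def addr : TabVar tb.K → ℕ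
  | .x j => enc tb 0 0 j 0 0
  | .yp j => enc tb 1 0 j 0 0
  | .yv j => enc tb 2 0 j 0 0
  | .u s q => enc tb 3 0 s q 0
  | .h κ s j => enc tb 4 κ s j 0
  | .hc κ s j => enc tb 5 κ s j 0
  | .r κ ℓ p w => enc tb 6 κ p ℓ w
  | .sw κ ℓ q => enc tb 7 κ q ℓ 0
  | .lt κ p i => enc tb 8 κ p i 0
  | .ae κ p j => enc tb 9 κ p j 0
  | .dummy => enc tb 11 0 0 0 0
  | .aux c m => tb.VMAIN + (256 * c + m)

/-- Well-formed variables: main variables with digits within their radices. [folklore] -/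
def WF : TabVar tb.K → Prop
  | .x j => j < tb.S2
  | .yp j => j < tb.S2
  | .yv j => j < tb.S2
  | .u s q => s < tb.S2 ∧ q < tb.D
  | .h _ s j => s < tb.S2 ∧ j < tb.D
  | .hc _ s j => s < tb.S2 ∧ j < tb.D
  | .r _ ℓ p w => p < tb.S2 ∧ ℓ < tb.D ∧ w < tb.D
  | .sw _ ℓ q => q < tb.S2 ∧ ℓ < tb.D
  | .lt _ p i => p < tb.S2 ∧ i < tb.D
  | .ae _ p j => p < tb.S2 ∧ j < tb.D
  | .aux _ _ => False
  | .dummy => True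

/-- Encoded addresses with in-range digits lie in the main block. [folklore] -/
theorem enc_lt {t κ s a b : ℕ} (ht : t < 16) (hκ : κ < tb.K) (hs : s < tb.S2) (ha : a < tb.D) (hb : b < tb.D) :
    enc tb t κ s a b < tb.VMAIN := by
  unfold enc TabParams.VMAIN
  have := mix_lt tb hκ hs ha hb
  omega

/-- `0 < D`, `0 < S2` (so that index `0` is in range). [folklore] -/
theorem D_pos : 0 < tb.D := by unfold TabParams.D; omega
/-- `S2_pos` (auxiliary). [folklore] -/
theorem S2_pos : 0 < tb.S2 := by unfold TabParams.S2 TabParams.S; have := Nat.two_pow_pos tb.k; omega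
/-- `K_pos` (auxiliary). [folklore] -/
theorem K_pos : 0 < tb.K := tb.inp.pos

/-- Well-formed main variables are laid out in the main block. [folklore] -/
theorem addr_lt_of_wf {v : TabVar tb.K} (hw : WF tb v) : addr tb v < tb.VMAIN := by
  have hD := D_pos tb; have hS := S2_pos tb; have hK := K_pos tb
  cases v <;> simp only [WF] at hw <;> simp only [addr]
  all_goals first
    | exact enc_lt tb (by decide) hK hw hD hD
    | exact enc_lt tb (by decide) hK hw.1 hw.2 hD
    | exact enc_lt tb (by decide) (Fin.is_lt _) hw.1 hw.2 hD
    | exact enc_lt tb (by decide) (Fin.is_lt _) hw.1 hw.2.1 hw.2.2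
    | exact enc_lt tb (by decide) hK hS hD hD

/-- Auxiliary addresses lie above the main block. [folklore] -/
theorem VMAIN_le_addr_aux (c m : ℕ) : tb.VMAIN ≤ addr tb (.aux c m) := Nat.le_add_right _ _

/-- **Decoding an address** (a left inverse of `addr` on well-formed variables). [folklore] -/
def decV (u : ℕ) : TabVar tb.K :=
  if u < tb.VMAIN then
    let t := u % 16
    let r := u / 16
    let κ : Fin tb.K := ⟨r % tb.K, Nat.mod_lt _ (K_pos tb)⟩
    let r1 := r / tb.K
    let s := r1 % tb.S2
    let r2 := r1 / tb.S2
    let a := r2 % tb.D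
    let b := r2 / tb.D
    if t = 0 then .x s else if t = 1 then .yp s else if t = 2 then .yv s
    else if t = 3 then .u s a else if t = 4 then .h κ s a else if t = 5 then .hc κ s a
    else if t = 6 then .r κ a s b else if t = 7 then .sw κ a s else if t = 8 then .lt κ s a
    else if t = 9 then .ae κ s a else .dummy
  else .aux ((u - tb.VMAIN) / 256) ((u - tb.VMAIN) % 256)

/-- Digits of an encoded address. [folklore] -/
theorem enc_digits {t κ s a b : ℕ} (ht : t < 16) (hκ : κ < tb.K) (hs : s < tb.S2) (ha : a < tb.D) :
    enc tb t κ s a b % 16 = t ∧ enc tb t κ s a b / 16 % tb.K = κ ∧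
    enc tb t κ s a b / 16 / tb.K % tb.S2 = s ∧ enc tb t κ s a b / 16 / tb.K / tb.S2 % tb.D = a ∧
    enc tb t κ s a b / 16 / tb.K / tb.S2 / tb.D = b := by
  have hK := K_pos tb; have hS := S2_pos tb; have hD := D_pos tb
  have h16 : enc tb t κ s a b / 16 = mix tb κ s a b := by
    unfold enc; rw [Nat.add_mul_div_left _ _ (by decide), Nat.div_eq_of_lt ht, Nat.zero_add]
  refine ⟨by unfold enc; rw [Nat.add_mul_mod_self_left, Nat.mod_eq_of_lt ht], ?_, ?_, ?_, ?_⟩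
  · rw [h16, mix_mod tb _ _ _ _ hκ]
  · rw [h16, mix_div tb _ _ _ _ hκ, Nat.add_mul_mod_self_left, Nat.mod_eq_of_lt hs]
  · rw [h16, mix_div tb _ _ _ _ hκ, Nat.add_mul_div_left _ _ hS, Nat.div_eq_of_lt hs, Nat.zero_add,
      Nat.add_mul_mod_self_left, Nat.mod_eq_of_lt ha]
  · rw [h16, mix_div tb _ _ _ _ hκ, Nat.add_mul_div_left _ _ hS, Nat.div_eq_of_lt hs, Nat.zero_add,
      Nat.add_mul_div_left _ _ hD, Nat.div_eq_of_lt ha, Nat.zero_add]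

/-- **`decV` inverts `addr` on well-formed variables.** [folklore] -/
theorem decV_addr {v : TabVar tb.K} (hw : WF tb v) : decV tb (addr tb v) = v := by
  have hD := D_pos tb; have hS := S2_pos tb; have hK := K_pos tb
  cases v with
  | aux c m => exact absurd hw id
  | x j =>
    simp only [WF] at hw
    have hlt := enc_lt tb (show 0 < 16 by decide) hK hw hD hD
    obtain ⟨e1, -, e3, -, -⟩ := enc_digits tb (show 0 < 16 by decide) hK hw hD (b := 0)
    unfold decV addr; rw [if_pos hlt]; simp only []; rw [e1, if_pos rfl, e3]
  | yp j =>
    simp only [WF] at hw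
    have hlt := enc_lt tb (show 1 < 16 by decide) hK hw hD hD
    obtain ⟨e1, -, e3, -, -⟩ := enc_digits tb (show 1 < 16 by decide) hK hw hD (b := 0)
    unfold decV addr; rw [if_pos hlt]; simp only []; rw [e1]; simp only [show (1:ℕ) ≠ 0 by decide, if_false, if_true]; rw [e3]
  | yv j =>
    simp only [WF] at hw
    have hlt := enc_lt tb (show 2 < 16 by decide) hK hw hD hD
    obtain ⟨e1, -, e3, -, -⟩ := enc_digits tb (show 2 < 16 by decide) hK hw hD (b := 0)
    unfold decV addr; rw [if_pos hlt]; simp only []; rw [e1]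
    simp only [show (2:ℕ) ≠ 0 by decide, show (2:ℕ) ≠ 1 by decide, if_false, if_true]; rw [e3]
  | u s q =>
    simp only [WF] at hw
    have hlt := enc_lt tb (show 3 < 16 by decide) hK hw.1 hw.2 hD
    obtain ⟨e1, -, e3, e4, -⟩ := enc_digits tb (show 3 < 16 by decide) hK hw.1 hw.2 (b := 0)
    unfold decV addr; rw [if_pos hlt]; simp only []; rw [e1]
    simp only [show (3:ℕ) ≠ 0 by decide, show (3:ℕ) ≠ 1 by decide, show (3:ℕ) ≠ 2 by decide, if_false, if_true]
    rw [e3, e4]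
  | h κ s j =>
    simp only [WF] at hw
    have hlt := enc_lt tb (show 4 < 16 by decide) κ.2 hw.1 hw.2 hD
    obtain ⟨e1, e2, e3, e4, -⟩ := enc_digits tb (show 4 < 16 by decide) κ.2 hw.1 hw.2 (b := 0)
    unfold decV addr; rw [if_pos hlt]; simp only []; rw [e1]
    simp only [show (4:ℕ) ≠ 0 by decide, show (4:ℕ) ≠ 1 by decide, show (4:ℕ) ≠ 2 by decide,
      show (4:ℕ) ≠ 3 by decide, if_false, if_true]
    rw [e3, e4]; congr 1; exact Fin.ext e2
  | hc κ s j =>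
    simp only [WF] at hw
    have hlt := enc_lt tb (show 5 < 16 by decide) κ.2 hw.1 hw.2 hD
    obtain ⟨e1, e2, e3, e4, -⟩ := enc_digits tb (show 5 < 16 by decide) κ.2 hw.1 hw.2 (b := 0)
    unfold decV addr; rw [if_pos hlt]; simp only []; rw [e1]
    simp only [show (5:ℕ) ≠ 0 by decide, show (5:ℕ) ≠ 1 by decide, show (5:ℕ) ≠ 2 by decide,
      show (5:ℕ) ≠ 3 by decide, show (5:ℕ) ≠ 4 by decide, if_false, if_true]
    rw [e3, e4]; congr 1; exact Fin.ext e2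
  | r κ ℓ p w =>
    simp only [WF] at hw
    have hlt := enc_lt tb (show 6 < 16 by decide) κ.2 hw.1 hw.2.1 hw.2.2
    obtain ⟨e1, e2, e3, e4, e5⟩ := enc_digits tb (show 6 < 16 by decide) κ.2 hw.1 hw.2.1 (b := w)
    unfold decV addr; rw [if_pos hlt]; simp only []; rw [e1]
    simp only [show (6:ℕ) ≠ 0 by decide, show (6:ℕ) ≠ 1 by decide, show (6:ℕ) ≠ 2 by decide,
      show (6:ℕ) ≠ 3 by decide, show (6:ℕ) ≠ 4 by decide, show (6:ℕ) ≠ 5 by decide, if_false, if_true]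
    rw [e3, e4, e5]; congr 1; exact Fin.ext e2
  | sw κ ℓ q =>
    simp only [WF] at hw
    have hlt := enc_lt tb (show 7 < 16 by decide) κ.2 hw.1 hw.2 hD
    obtain ⟨e1, e2, e3, e4, -⟩ := enc_digits tb (show 7 < 16 by decide) κ.2 hw.1 hw.2 (b := 0)
    unfold decV addr; rw [if_pos hlt]; simp only []; rw [e1]
    simp only [show (7:ℕ) ≠ 0 by decide, show (7:ℕ) ≠ 1 by decide, show (7:ℕ) ≠ 2 by decide,
      show (7:ℕ) ≠ 3 by decide, show (7:ℕ) ≠ 4 by decide, show (7:ℕ) ≠ 5 by decide,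
      show (7:ℕ) ≠ 6 by decide, if_false, if_true]
    rw [e3, e4]; congr 1; exact Fin.ext e2
  | lt κ p i =>
    simp only [WF] at hw
    have hlt := enc_lt tb (show 8 < 16 by decide) κ.2 hw.1 hw.2 hD
    obtain ⟨e1, e2, e3, e4, -⟩ := enc_digits tb (show 8 < 16 by decide) κ.2 hw.1 hw.2 (b := 0)
    unfold decV addr; rw [if_pos hlt]; simp only []; rw [e1]
    simp only [show (8:ℕ) ≠ 0 by decide, show (8:ℕ) ≠ 1 by decide, show (8:ℕ) ≠ 2 by decide,
      show (8:ℕ) ≠ 3 by decide, show (8:ℕ) ≠ 4 by decide, show (8:ℕ) ≠ 5 by decide,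
      show (8:ℕ) ≠ 6 by decide, show (8:ℕ) ≠ 7 by decide, if_false, if_true]
    rw [e3, e4]; congr 1; exact Fin.ext e2
  | ae κ p j =>
    simp only [WF] at hw
    have hlt := enc_lt tb (show 9 < 16 by decide) κ.2 hw.1 hw.2 hD
    obtain ⟨e1, e2, e3, e4, -⟩ := enc_digits tb (show 9 < 16 by decide) κ.2 hw.1 hw.2 (b := 0)
    unfold decV addr; rw [if_pos hlt]; simp only []; rw [e1]
    simp only [show (9:ℕ) ≠ 0 by decide, show (9:ℕ) ≠ 1 by decide, show (9:ℕ) ≠ 2 by decide,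
      show (9:ℕ) ≠ 3 by decide, show (9:ℕ) ≠ 4 by decide, show (9:ℕ) ≠ 5 by decide,
      show (9:ℕ) ≠ 6 by decide, show (9:ℕ) ≠ 7 by decide, show (9:ℕ) ≠ 8 by decide, if_false, if_true]
    rw [e3, e4]; congr 1; exact Fin.ext e2
  | dummy =>
    have hlt := enc_lt tb (show 11 < 16 by decide) hK hS hD hD
    obtain ⟨e1, -, -, -, -⟩ := enc_digits tb (show 11 < 16 by decide) hK hS hD (b := 0)
    unfold decV addr; rw [if_pos hlt]; simp only []; rw [e1]
    simp only [show (11:ℕ) ≠ 0 by decide, show (11:ℕ) ≠ 1 by decide, show (11:ℕ) ≠ 2 by decide,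
      show (11:ℕ) ≠ 3 by decide, show (11:ℕ) ≠ 4 by decide, show (11:ℕ) ≠ 5 by decide,
      show (11:ℕ) ≠ 6 by decide, show (11:ℕ) ≠ 7 by decide, show (11:ℕ) ≠ 8 by decide,
      show (11:ℕ) ≠ 9 by decide, if_false]

/-! ### The numbered constraints and the clause function -/

/-- The variables of a constraint by position. [folklore] -/
def ACon.varOf {K : ℕ} (c : ACon K) : Fin 6 → TabVar K
  | ⟨0, _⟩ => c.v₀
  | ⟨1, _⟩ => c.v₁
  | ⟨2, _⟩ => c.v₂
  | ⟨3, _⟩ => c.v₃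
  | ⟨4, _⟩ => c.v₄
  | ⟨5, _⟩ => c.v₅
  | ⟨_ + 6, h⟩ => absurd h (by omega)

/-- A tableau constraint as a numeric constraint of the clause compiler. [folklore] -/
def toCon (c : ACon tb.K) : ThreeCNF.Con :=
  ⟨fun i => addr tb (c.varOf i), fun f => c.pred (f 0) (f 1) (f 2) (f 3) (f 4) (f 5)⟩

/-- Satisfaction is transported along the layout. [folklore] -/
theorem sat_toCon_iff (c : ACon tb.K) (σ : ℕ → Bool) :
    (toCon tb c).Sat σ ↔ c.Sat (fun v => σ (addr tb v)) := Iff.rfl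

/-- The index tuple of a constraint id. [folklore] -/
def tupOf (id : ℕ) : ℕ × ℕ × ℕ × ℕ × ℕ :=
  (id % 32, id / 32 % tb.K, id / 32 / tb.K % tb.S2, id / 32 / tb.K / tb.S2 % tb.D, id / 32 / tb.K / tb.S2 / tb.D)

/-- **The numbered constraints.** [folklore] -/
def conN (id : ℕ) : ThreeCNF.Con :=
  let u := tupOf tb id
  toCon tb (conOf tb u.1 u.2.1 u.2.2.1 u.2.2.2.1 u.2.2.2.2)

/-- The auxiliary block of constraint `id`. [folklore] -/
def auxBase (id : ℕ) : ℕ := tb.VMAIN + 256 * id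

/-- **The clause function of the tableau**: unit clauses `xᵢ = b` for `i < n`, then the
compiled constraints, `256` clauses each, then tautologies. [cite: FortnowEtAl2005, §3.1] -/
def skTab (i : ℕ) (b : Bool) : Clause ℕ :=
  if i < tb.n then [(addr tb (.x i), b)]
  else if i < tb.NCl then
    (conN tb ((i - tb.n) / 256)).clause (auxBase tb ((i - tb.n) / 256)) ((i - tb.n) % 256)
  else tautClause

/-- Clauses of the tableau have width at most `3`. [folklore] -/
theorem length_skTab_le (i : ℕ) (b : Bool) : (skTab tb i b).length ≤ 3 := by
  unfold skTab; split_ifs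
  · simp
  · exact ThreeCNF.Con.length_clause_le _ _ _
  · simp

/-- From `n + 256 · NC` on the clauses are `tautClause`. [folklore] -/
theorem skTab_taut {i : ℕ} (hi : tb.NCl ≤ i) (b : Bool) : skTab tb i b = tautClause := by
  unfold skTab
  rw [if_neg (by unfold TabParams.NCl at hi; omega), if_neg (by omega)]

/-! ### The variables of the constraints are well formed -/

section WFCon

variable {tb}

/-- Size facts. [folklore] -/
theorem sizes (hfit : tb.Send < tb.S) : tb.S2 = 2 * tb.S ∧ tb.D = tb.W + tb.np + 2 ∧ tb.W = 2 * tb.k + 4 ∧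
    tb.L = 2 * tb.k ∧ tb.I = tb.Y + (2 * tb.n + 2) ∧ tb.Send = tb.I + tb.T ∧ 0 < tb.S ∧ tb.Send < tb.S :=
  ⟨rfl, rfl, rfl, rfl, rfl, rfl, Nat.two_pow_pos _, hfit⟩

/-- The variables of the trivial constraint are well formed. [folklore] -/
theorem wf_triv (i : Fin 6) : WF tb ((ACon.triv tb.K).varOf i) := by
  fin_cases i <;> exact trivial

/-- **Every variable of the flat family is well formed** (given `Send < S`). [folklore] -/
theorem wf_conOf (hfit : tb.Send < tb.S) (fam κi si ai bi : ℕ) (i : Fin 6) :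
    WF tb ((conOf tb fam κi si ai bi).varOf i) := by
  obtain ⟨hS2, hD, hW, hL, hI, hSe, hS, -⟩ := sizes hfit
  unfold conOf
  by_cases hκ : κi < tb.K
  swap
  · rw [dif_neg hκ]; exact wf_triv i
  rw [dif_pos hκ]
  by_cases hbox : fam < 32 ∧ si < tb.S2 ∧ ai < tb.D ∧ bi < tb.D
  swap
  · rw [if_neg hbox]; exact wf_triv i
  rw [if_pos hbox]
  set κ : Fin tb.K := ⟨κi, hκ⟩
  unfold conCore
  match fam with
  | 0 =>
    show WF tb ((famRecV1 tb si).varOf i)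
    unfold famRecV1; split_ifs with h
    · fin_cases i
      all_goals simp only [ACon.varOf, WF, rv, fT1, fT0, fSym]
      all_goals omega
    · exact wf_triv i
  | 1 =>
    show WF tb ((famRecV2 tb si).varOf i)
    unfold famRecV2; split_ifs with h
    · have hv : ∀ j, v2src tb.n si = Sum.inr j → j < tb.n := by
        intro j hj; unfold v2src at hj; split_ifs at hj; cases hj; omega
      rcases hv2 : v2src tb.n si with b | j
      · fin_cases i
        all_goals simp only [ACon.varOf, WF, rv, fT1, fT0, fSym]
        all_goals omega
      · have := hv j hv2
        fin_cases i
        all_goals simp only [ACon.varOf, WF, rv, fT1, fT0, fSym]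
        all_goals omega
    · exact wf_triv i
  | 2 =>
    show WF tb ((famRecNop tb κ si).varOf i)
    unfold famRecNop; split_ifs with h
    · fin_cases i
      all_goals simp only [ACon.varOf, WF, rv, fT1, fT0]
      all_goals omega
    · exact wf_triv i
  | 3 =>
    show WF tb ((famRecM tb κ si ai).varOf i)
    unfold famRecM; split_ifs with h
    · fin_cases i
      all_goals simp only [ACon.varOf, WF, rv, fT1, fT0, fSym]
      all_goals omega
    · exact wf_triv i
  | 4 =>
    show WF tb ((famRecF tb).varOf i)
    fin_cases i
    all_goals simp only [famRecF, ACon.varOf, WF, rv, fT1, fT0, fSym]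
    all_goals omega
  | 5 =>
    show WF tb ((famTime tb κ si ai).varOf i)
    unfold famTime; split_ifs with h
    · fin_cases i
      all_goals simp only [ACon.varOf, WF, rv, TabParams.fTim]
      all_goals omega
    · exact wf_triv i
  | 6 =>
    show WF tb ((famLev tb κ si ai).varOf i)
    unfold famLev; split_ifs with h
    · fin_cases i
      all_goals simp only [ACon.varOf, WF, rv, fT1, fT0, fLev]
      all_goals omega
    · exact wf_triv i
  | 7 =>
    show WF tb ((famH0 tb κ ai).varOf i)
    unfold famH0; split_ifs with h
    · fin_cases i
      all_goals simp only [ACon.varOf, WF]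
      all_goals omega
    · exact wf_triv i
  | 8 =>
    show WF tb ((famHc0 tb κ si).varOf i)
    unfold famHc0; split_ifs with h
    · fin_cases i
      all_goals simp only [ACon.varOf, WF]
      all_goals omega
    · exact wf_triv i
  | 9 =>
    show WF tb ((famHcK tb κ si).varOf i)
    unfold famHcK; split_ifs with h
    · fin_cases i
      all_goals simp only [ACon.varOf, WF, rv, fT0]
      all_goals omega
    · exact wf_triv i
  | 10 =>
    show WF tb ((famHstep tb κ si ai).varOf i)
    unfold famHstep; split_ifs with h
    · fin_cases i
      all_goals simp only [ACon.varOf, WF, rv, fT1, fT0]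
      all_goals omega
    · exact wf_triv i
  | 11 =>
    show WF tb ((famU0 tb).varOf i)
    fin_cases i
    all_goals simp only [famU0, ACon.varOf, WF]
    all_goals omega
  | 12 =>
    show WF tb ((famU2 tb si ai bi).varOf i)
    unfold famU2; split_ifs with h
    · fin_cases i
      all_goals simp only [ACon.varOf, WF]
      all_goals omega
    · exact wf_triv i
  | 13 =>
    show WF tb ((famTr tb si ai bi).varOf i)
    unfold famTr
    by_cases h : tb.I ≤ si ∧ si < tb.Send ∧ ai ≤ tb.np ∧ bi < 3
    swap
    · rw [if_neg h]; exact wf_triv i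
    rw [if_pos h]
    have htgt : ∀ (tgt : ℕ), WF tb (if tgt ≤ tb.np then TabVar.u (si + 1) tgt else .dummy) := by
      intro tgt
      by_cases ht : tgt ≤ tb.np
      · rw [if_pos ht]; simp only [WF]; omega
      · rw [if_neg ht]; trivial
    rcases hP : tb.P[ai]? with _ | ⟨k, a⟩ | ⟨k, j⟩ | ⟨j⟩ <;> simp only []
    · by_cases hb : bi = 0
      · rw [if_pos hb]
        fin_cases i
        all_goals simp only [ACon.varOf, WF]
        all_goals first | omega | exact htgt _
      · rw [if_neg hb]; exact wf_triv i
    · by_cases hb : bi = 0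
      · rw [if_pos hb]
        fin_cases i
        all_goals simp only [ACon.varOf, WF]
        all_goals first | omega | exact htgt _
      · rw [if_neg hb]; exact wf_triv i
    · fin_cases i
      all_goals simp only [ACon.varOf, WF, rv, fT0, fSym]
      all_goals first | omega | exact htgt _
    · by_cases hb : bi = 0
      · rw [if_pos hb]
        fin_cases i
        all_goals simp only [ACon.varOf, WF]
        all_goals first | omega | exact htgt _
      · rw [if_neg hb]; exact wf_triv i
  | 14 =>
    show WF tb ((famAcc tb).varOf i)
    fin_cases i
    all_goals simp only [famAcc, ACon.varOf, WF]
    all_goals omega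
  | 15 =>
    show WF tb ((famNet tb κ si ai bi).varOf i)
    unfold famNet; split_ifs with h
    · have hd := dim_lt tb h.1
      have hfl : flipBit (tb.dim ai) si < tb.S := flipBit_lt hd h.2.1
      have hbs := base_le (tb.dim ai) si
      fin_cases i
      all_goals simp only [ACon.varOf, WF, rv]
      all_goals omega
    · exact wf_triv i
  | 16 =>
    show WF tb ((famLt0 tb κ si).varOf i)
    unfold famLt0; split_ifs with h
    · fin_cases i
      all_goals simp only [ACon.varOf, WF]
      all_goals omega
    · exact wf_triv i
  | 17 =>
    show WF tb ((famLtStep tb κ si ai).varOf i)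
    unfold famLtStep; split_ifs with h
    · have hk := fKey_lt tb h.2
      fin_cases i
      all_goals simp only [ACon.varOf, WF, rv]
      all_goals omega
    · exact wf_triv i
  | 18 =>
    show WF tb ((famLtF tb κ si).varOf i)
    unfold famLtF; split_ifs with h
    · fin_cases i
      all_goals simp only [ACon.varOf, WF]
      all_goals omega
    · exact wf_triv i
  | 19 =>
    show WF tb ((famAe0 tb κ si).varOf i)
    unfold famAe0; split_ifs with h
    · fin_cases i
      all_goals simp only [ACon.varOf, WF]
      all_goals omega
    · exact wf_triv i
  | 20 =>
    show WF tb ((famAeStep tb κ si ai).varOf i)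
    unfold famAeStep; split_ifs with h
    · fin_cases i
      all_goals simp only [ACon.varOf, WF, rv, fLev]
      all_goals omega
    · exact wf_triv i
  | 21 =>
    show WF tb ((famAdj1 tb κ si).varOf i)
    unfold famAdj1; split_ifs with h
    · fin_cases i
      all_goals simp only [ACon.varOf, WF, rv, fT1, fT0]
      all_goals omega
    · exact wf_triv i
  | 22 =>
    show WF tb ((famAdj2 tb κ si).varOf i)
    unfold famAdj2; split_ifs with h
    · fin_cases i
      all_goals simp only [ACon.varOf, WF, rv, fT1, fT0, fSym]
      all_goals omega
    · exact wf_triv i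
  | 23 =>
    show WF tb ((famFirst tb κ).varOf i)
    fin_cases i
    all_goals simp only [famFirst, ACon.varOf, WF, rv, fT1, fT0]
    all_goals omega
  | n + 24 => exact wf_triv i

end WFCon

/-! ### Bounds on the variables -/

section Bounds

variable {tb}

/-- Unpacking a constraint id built from an in-box tuple. [folklore] -/
theorem tupOf_mk {fam κi si ai bi : ℕ} (hf : fam < 32) (hκ : κi < tb.K) (hs : si < tb.S2) (ha : ai < tb.D) :
    tupOf tb (fam + 32 * mix tb κi si ai bi) = (fam, κi, si, ai, bi) := by
  have hK := K_pos tb; have hS := S2_pos tb; have hD := D_pos tb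
  unfold tupOf
  have h32 : (fam + 32 * mix tb κi si ai bi) / 32 = mix tb κi si ai bi := by
    rw [Nat.add_mul_div_left _ _ (by decide), Nat.div_eq_of_lt hf, Nat.zero_add]
  rw [Nat.add_mul_mod_self_left, Nat.mod_eq_of_lt hf, h32, mix_mod tb _ _ _ _ hκ, mix_div tb _ _ _ _ hκ,
    Nat.add_mul_mod_self_left, Nat.mod_eq_of_lt hs, Nat.add_mul_div_left _ _ hS, Nat.div_eq_of_lt hs,
    Nat.zero_add, Nat.add_mul_mod_self_left, Nat.mod_eq_of_lt ha, Nat.add_mul_div_left _ _ hD,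
    Nat.div_eq_of_lt ha, Nat.zero_add]

/-- An in-box tuple has a constraint id below `NC`. [folklore] -/
theorem mk_lt_NC {fam κi si ai bi : ℕ} (hf : fam < 32) (hκ : κi < tb.K) (hs : si < tb.S2) (ha : ai < tb.D)
    (hb : bi < tb.D) : fam + 32 * mix tb κi si ai bi < tb.NC := by
  have := mix_lt tb hκ hs ha hb
  unfold TabParams.NC; omega

/-- Outside the box the flat family is trivial. [folklore] -/
theorem conOf_of_not_box {fam κi si ai bi : ℕ}
    (h : ¬ (fam < 32 ∧ κi < tb.K ∧ si < tb.S2 ∧ ai < tb.D ∧ bi < tb.D)) :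
    conOf tb fam κi si ai bi = ACon.triv tb.K := by
  unfold conOf
  by_cases hκ : κi < tb.K
  · rw [dif_pos hκ, if_neg (fun hb => h ⟨hb.1, hκ, hb.2⟩)]
  · rw [dif_neg hκ]

/-- **All variables of the presented formula are below `Vtot`.** [folklore] -/
theorem vars_skTab_lt (hfit : tb.Send < tb.S) (i : ℕ) (b : Bool) : ∀ l ∈ skTab tb i b, l.1 < tb.Vtot := by
  obtain ⟨hS2, hD, hW, hL, hI, hSe, hS, -⟩ := sizes hfit
  have hVt : tb.Vtot = tb.VMAIN + 256 * tb.NC := rfl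
  have hV0 : 0 < tb.VMAIN := by
    have := enc_lt tb (show 11 < 16 by decide) (K_pos tb) (S2_pos tb) (D_pos tb) (D_pos tb); omega
  intro l hl
  unfold skTab at hl
  split_ifs at hl with h1 h2
  · simp only [List.mem_singleton] at hl
    subst hl
    have : WF tb (TabVar.x i : TabVar tb.K) := by show i < tb.S2; omega
    have := addr_lt_of_wf tb this
    simp only []; omega
  · have hid : (i - tb.n) / 256 < tb.NC := by
      unfold TabParams.NCl at h2
      exact Nat.div_lt_of_lt_mul (by omega)
    set u := tupOf tb ((i - tb.n) / 256) with hu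
    rcases ThreeCNF.Con.vars_clause _ _ _ l hl with ⟨i', hi'⟩ | ⟨m, hm, hlm⟩ | h0
    · rw [hi']
      show addr tb ((conOf tb u.1 u.2.1 u.2.2.1 u.2.2.2.1 u.2.2.2.2).varOf i') < _
      have := addr_lt_of_wf tb (wf_conOf hfit u.1 u.2.1 u.2.2.1 u.2.2.2.1 u.2.2.2.2 i')
      omega
    · rw [hlm]; unfold auxBase; omega
    · rw [h0]; omega
  · simp only [tautClause, List.mem_cons, List.not_mem_nil, or_false] at hl
    rcases hl with rfl | rfl <;> simp <;> omega

end Bounds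

/-! ### Satisfiability of the presented formula -/

section Sat

variable {tb}

/-- Satisfaction of a constraint only reads its six variables. [folklore] -/
theorem ACon.sat_congr {K : ℕ} (c : ACon K) {τ τ' : TabVar K → Bool}
    (h : ∀ i, τ (c.varOf i) = τ' (c.varOf i)) : c.Sat τ ↔ c.Sat τ' := by
  unfold ACon.Sat
  rw [show c.v₀ = c.varOf 0 from rfl, show c.v₁ = c.varOf 1 from rfl, show c.v₂ = c.varOf 2 from rfl,
    show c.v₃ = c.varOf 3 from rfl, show c.v₄ = c.varOf 4 from rfl, show c.v₅ = c.varOf 5 from rfl,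
    h, h, h, h, h, h]

/-- **Satisfiability of the presented formula is `TabOK` with the input spelled on the
input-copy variables.** [cite: FortnowEtAl2005, §3.1] -/
theorem sat_skTab_iff (hfit : tb.Send < tb.S) (x : List Bool) :
    (∃ σ : ℕ → Bool, ∀ i, (skTab tb i (x.getD i false)).eval σ = true) ↔
      ∃ τ : TabVar tb.K → Bool, TabOK tb τ ∧ ∀ j < tb.n, τ (.x j) = x.getD j false := by
  obtain ⟨hS2, hD, hW, hL, hI, hSe, hS, -⟩ := sizes hfit
  have hNCl : tb.NCl = tb.n + 256 * tb.NC := rfl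
  constructor
  · rintro ⟨σ, hσ⟩
    refine ⟨fun v => σ (addr tb v), tabOK_of_forall hfit fun fam κi si ai bi => ?_, fun j hj => ?_⟩
    · by_cases hbox : fam < 32 ∧ κi < tb.K ∧ si < tb.S2 ∧ ai < tb.D ∧ bi < tb.D
      · obtain ⟨hf, hκ, hs, ha, hb⟩ := hbox
        set id := fam + 32 * mix tb κi si ai bi with hid
        have hidN : id < tb.NC := mk_lt_NC hf hκ hs ha hb
        have hcon : conN tb id = toCon tb (conOf tb fam κi si ai bi) := by
          unfold conN; rw [hid, tupOf_mk hf hκ hs ha]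
        rw [← sat_toCon_iff, ← hcon]
        refine ThreeCNF.sat_of_clauses (aux := auxBase tb id) fun j hj => ?_
        have hi := hσ (tb.n + 256 * id + j)
        unfold skTab at hi
        rw [if_neg (by omega), if_pos (by rw [hNCl]; omega), show tb.n + 256 * id + j - tb.n = 256 * id + j by omega,
          Nat.mul_add_div (by decide), Nat.div_eq_of_lt hj, Nat.add_zero, Nat.mul_add_mod,
          Nat.mod_eq_of_lt hj] at hi
        exact hi
      · rw [conOf_of_not_box hbox]; exact ACon.sat_triv _
    · have hi := hσ j
      unfold skTab at hi
      rw [if_pos hj] at hi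
      simpa [Clause.eval, Literal.eval] using hi
  · rintro ⟨τ, hT, hx⟩
    let σ : ℕ → Bool := fun u =>
      if u < tb.VMAIN then τ (decV tb u)
      else ThreeCNF.zval (fun i => τ (decV tb ((conN tb ((u - tb.VMAIN) / 256)).vars i)))
        ((u - tb.VMAIN) % 256)
    have hmain : ∀ v, WF tb v → σ (addr tb v) = τ v := fun v hw => by
      simp only [σ, if_pos (addr_lt_of_wf tb hw), decV_addr tb hw]
    refine ⟨σ, fun i => ?_⟩
    unfold skTab
    split_ifs with h1 h2
    · have hw : WF tb (TabVar.x i : TabVar tb.K) := by show i < tb.S2; omega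
      simp [Clause.eval, Literal.eval, hmain _ hw, hx i h1]
    · set id := (i - tb.n) / 256 with hid
      have hidN : id < tb.NC := by rw [hNCl] at h2; exact Nat.div_lt_of_lt_mul (by omega)
      -- the six variables of the constraint are well formed main variables
      set u := tupOf tb id with hu
      have hwf : ∀ i', WF tb ((conOf tb u.1 u.2.1 u.2.2.1 u.2.2.2.1 u.2.2.2.2).varOf i') := fun i' =>
        wf_conOf hfit _ _ _ _ _ i'
      have hvars : ∀ i', σ ((conN tb id).vars i') = τ ((conOf tb u.1 u.2.1 u.2.2.1 u.2.2.2.1 u.2.2.2.2).varOf i') :=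
        fun i' => hmain _ (hwf i')
      have hdec : ∀ i', τ (decV tb ((conN tb id).vars i')) =
          τ ((conOf tb u.1 u.2.1 u.2.2.1 u.2.2.2.1 u.2.2.2.2).varOf i') := fun i' => by
        show τ (decV tb (addr tb _)) = _; rw [decV_addr tb (hwf i')]
      have hfun : (fun i' => σ ((conN tb id).vars i')) = fun i' => τ (decV tb ((conN tb id).vars i')) :=
        funext fun i' => (hvars i').trans (hdec i').symm
      refine ThreeCNF.clauses_of_sat ?_ (fun m hm => ?_) _
      · change (toCon tb (conOf tb u.1 u.2.1 u.2.2.1 u.2.2.2.1 u.2.2.2.2)).Sat σ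
        rw [sat_toCon_iff, ACon.sat_congr _ (fun i' => hvars i')]
        exact forall_of_tabOK hT _ _ _ _ _
      · have hge : ¬ (auxBase tb id + m < tb.VMAIN) := by unfold auxBase; omega
        have hsub : auxBase tb id + m - tb.VMAIN = 256 * id + m := by unfold auxBase; omega
        rw [hfun]
        show (if auxBase tb id + m < tb.VMAIN then _ else _) = _
        rw [if_neg hge, hsub, Nat.mul_add_div (by decide : (0:ℕ) < 256), Nat.div_eq_of_lt hm, Nat.add_zero,
          Nat.mul_add_mod, Nat.mod_eq_of_lt hm]
    · exact eval_tautClause σ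

end Sat

end Layout

end Tableau

end Literature.Computability.Complexity
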